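import Summits.QuantumFields.BalabanUV.T4Continuum.Support.ShellMeasurePlaquetteCubicLocatedRowSum

/-!
# `T4Continuum.ShellMeasurePlaquetteCubicBoundary` — REPAIR of F-ne7cleaf02g9-1, part 1: the commutator part of the
# (39)-split gradient at a bond WITHOUT the full-star hypothesis (the NAIVE bound, sharp at the lowest scale), and
# row S77's located quadratic majorant re-concluded under the PER-BOND DICHOTOMY «full star in `Pl` OR weight `≤ L_b·η`»
(cell `pub-balaban`, sub-cell `t4`, spine estimate NE7c (node U5b); NE7c ROUND-2 crew, unit
`b2b-balaban-t4-ne7c-formalise-leaf-02` gen 9; owner table `t4/b2b-balaban-t4-ne7c-p1/LEAVES-NE7c-P1.md` rows S65∕S77;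
FINDING F-ne7cleaf02g9-1 (journal l.18166, GAPS l.27205, kernel `ShellMeasurePlaquetteStarClosure` p228731);
ADDITIVE — imports S77 file 4 `ShellMeasurePlaquetteCubicLocatedRowSum` (p227760) ONLY; [folklore]; 0 `def`,
0 `def … : Prop`, 0 sorry, 0 citation tags)

HONEST FRAMING.  Finite four-torus programme, rung (B)+1 only — NOT infinite volume, NOT a mass gap, NOT the Clay
problem, NOT summit progress; (B), `BetaPertHyp`, (B^μ) are not consumed.  NE7c (`T4IndicatorShell.ShellWeightBound`)
is NOT PRINTED in [Balaban 1983–89] and NOT PROVED; «NE7c ⇐ the named binders» (trigger c3, WALL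
`t4/b2b-balaban-t4-ne7c-p1/WALL-NE7c-P1.md` §2b).  ELEMENTARY estimates on b08's lattice calculus for OUR typed action;
[Balaban1985Variational] (39)∕(90)–(98) and p. 277 (1) ∕ p. 278 (5) LOCATE the shape only — the paper is under
adjudication; nothing printed is asserted or cited as a fact; no estimate of Bałaban's at a live level is discharged.
HONEST DEPENDENCY (cell): continuum YM on T⁴ ⇐ BetaPertH ∧ nine spine estimates (0/9 proved); BetaPertH ⇐ (D1) ∧ (D4)
∧ CAP+tail; G-an2-4 gates asym, D1 and NE2/3/4.

THE POINT.  F-ne7cleaf02g9-1: the S65∕S77 ENDs assumed the FULL plaquette star of EVERY `Λ`-bond inside `Pl` together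
with «every letter of every `p ∈ Pl` is a `Λ`-bond» — jointly inhabited only by `Λ = ∅` (d ≥ 2).  In print the
action sums `p ⊂ Ω₀` ((5)): bonds of `Ω₀` next to `Ω₀ᶜ` have INCOMPLETE stars, and by (1) they are LEVEL-0 bonds
(weight `η`), where the one-grid bound loses no `Lʲ` (locator `XREAD-P4-B11-SectB.md` §3 (k)).  So the star hypothesis
is needed only where the weight exceeds the lowest scale.  THIS FILE:
* §1 `norm_brk_le_at`, `norm_plaqCovDeriv_bump_le`, `norm_dcub_bump_le_at`, **`norm_sum_dcub_bump_le_partial`**: for ANY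
  finite set `Pl` of increasing plaquettes (NO star hypothesis) and local sups `a` (field on `nbhdSites`) ∕ `G`
  (covariant derivatives on `baseSites`): `‖Σ_{p∈Pl} δcub(B)[ι_{(y,κ)}X](p)‖ ≤ 96(d−1)‖w‖‖τ‖·(a²∕η + aG)·‖X‖` — the
  plaquettes through the bond that are present are `≤ 2(d−1)` star plaquettes, each bounded termwise (the `(DA)(p)`-slot
  keeps its `η⁻¹`: no summation by parts);
* §2 **`weighted_locGrad_cubT_le_located_low`**: at a bond `c` with `wt c ≤ L_b·η` (lowest scale) the `η⁻¹` is paid by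
  the weight: `(wt c)³‖locGrad (cubT …) A c‖ ≤ 96(d−1)‖w‖‖τ‖·(L_b·Lc²·((3d+2)d)·N₁ + Lc³·N)·Σ_{b : b.1.1 ∈ nbhdSites c} wt b‖A b‖`
  (`N₁ ≥ wt b‖A b‖` for all `b`, `N` = the ∇-datum size) — same located shape as S77 file 1's star bound;
NEXT FILES: `…PlaquetteCubicLocatedDich` (S77 file 1's two END shapes for ONE bond under the DICHOTOMY
`plaqStar c ⊆ Pl ∨ wt c ≤ L_b·η`, unified η-free stencil constant `K∇ = (d−1)‖τ‖(72Lc³ + 48L_b·Lc²·((3d+2)d))`), then the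
∀-bond assembly through S75 f2 with the explicit row sum and leaf-03's torus pin, and a NON-VACUITY witness.
Nothing in the countdown moves; NE7c NOT PROVED; spine PROVED 0∕9.
-/

noncomputable section

open scoped BigOperators

namespace Summit.QuantumFields.BalabanUV.T4Continuum.ShellMeasurePlaquetteCubicBoundary

open Literature.MathematicalPhysics.QuantumFieldTheory.Balaban1983to89
open B7Prop1Explicit (e U1 mem_U1)
open B7Eq78Linearization (conjR)
open B8Ineq132 (covDerivFwd norm_conjR_le)
open B8Eq146AExpansion (X1 X2 X3 X4 lin adR plaqCovDeriv)
open B8Eq151V2Divergence (brk norm_adR_le_of_le norm_lin_le)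
open ShellMeasureWilsonGradientTail (plaqWord bonds)
open ShellMeasurePlaquetteTwist (plaqFunSym)
open ShellMeasureLocalGradientTailJet (ord₃)
open Summit.QuantumFields.BalabanUV.T4Continuum.ShellMeasureCommutatorVariation
  (bump dcub dbrk plaqStar norm_bump_le card_plaqStar_le)
open Summit.QuantumFields.BalabanUV.T4Continuum.ShellMeasureCommutatorByParts (dcub_bump_eq_zero)
open Summit.QuantumFields.BalabanUV.T4Continuum.ShellMeasureCommutatorGradient (norm_add₆_le)
open Summit.QuantumFields.BalabanUV.T4Continuum.ShellMeasureCommutatorGradientLocal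
  (baseSites nbhdSites plaqStar_sites norm_plaqCovDeriv_le_at norm_dbrk_le_at mem_nbhdSites_self mem_baseSites_self
    norm_sum_dcub_bump_le_local)
open Summit.QuantumFields.BalabanUV.T4Continuum.ShellMeasureCommutatorLocGrad (ext ext_apply_of_mem ext_apply_of_not_mem cubT)
open Summit.QuantumFields.BalabanUV.T4Continuum.ShellMeasureLocalGradientTail (locGrad)
open Summit.QuantumFields.BalabanUV.T4Continuum.ShellMeasureMultiGridNorms
open Summit.QuantumFields.BalabanUV.T4Continuum.ShellMeasureMultiGridNormsMax
open Summit.QuantumFields.BalabanUV.T4Continuum.ShellMeasurePlaquetteCubicDictionary (V0remCov)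
open Summit.QuantumFields.BalabanUV.T4Continuum.ShellMeasurePlaquetteCubicCovBinders (analyticAt_V0remCov V0remCov_add_single)
open Summit.QuantumFields.BalabanUV.T4Continuum.ShellMeasureWilsonRemainderLevels (etaScale analyticAt_etaScale etaScale_add_single)
open Summit.QuantumFields.BalabanUV.T4Continuum.ShellMeasureWilsonRemainderLevelsCov (hcub_V0remCov_eta)
open Summit.QuantumFields.BalabanUV.T4Continuum.ShellMeasurePlaquetteCubicAssembly (restr_unit_bounded)
open Summit.QuantumFields.BalabanUV.T4Continuum.ShellMeasurePlaquetteCubicAssemblyLevels (locGrad_etaScale_sum_ord₃_eq)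
open Summit.QuantumFields.BalabanUV.T4Continuum.ShellMeasurePlaquetteCubicLocated
  (sum_filter_sum_eq_sum_card weighted_locGrad_le_located norm_ext_le_sum_nbhd weighted_locGrad_cubT_le_located)
open Summit.QuantumFields.BalabanUV.T4Continuum.ShellMeasurePlaquetteCubicLocatedRowSum (card_filter_nbhd_le)

export B7Prop1Explicit (Site)

variable {d : ℕ}

/-! ## §1 The naive bound of the commutator part at a bond — NO star hypothesis -/

section Naive

variable {𝔸 : Type*} [NormedRing 𝔸] [NormOneClass 𝔸] [NormedAlgebra ℂ 𝔸]

omit [NormedAlgebra ℂ 𝔸] in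
/-- `|{…}_B(p_{μν}(x))| ≤ 12a²` from the four bond values of `B` on `∂p` (`U1`-valued transports; six commutators).
[folklore] -/
theorem norm_brk_le_at {U₀ : Site d → Fin d → 𝔸ˣ} (h₀ : ∀ y κ, U₀ y κ ∈ U1 𝔸) {B : Site d → Fin d → 𝔸} {a : ℝ}
    {μ ν : Fin d} {x : Site d} (b1 : ‖B x μ‖ ≤ a) (b2 : ‖B (x + e μ) ν‖ ≤ a) (b3 : ‖B (x + e ν) μ‖ ≤ a)
    (b4 : ‖B x ν‖ ≤ a) : ‖brk U₀ B μ ν x‖ ≤ 12 * a * a := by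
  have e1 : ‖X1 B μ x‖ ≤ a := b1
  have e2 : ‖X2 U₀ B μ ν x‖ ≤ a := (norm_conjR_le (h₀ x μ) _).trans b2
  have e3 : ‖X3 U₀ B μ ν x‖ ≤ a := (norm_conjR_le (h₀ x ν) _).trans ((norm_neg _).trans_le b3)
  have e4 : ‖X4 B ν x‖ ≤ a := (norm_neg _).trans_le b4
  unfold brk
  refine (norm_add₆_le _ _ _ _ _ _).trans ?_
  have t1 := norm_adR_le_of_le e1 e2
  have t2 := norm_adR_le_of_le e1 e3
  have t3 := norm_adR_le_of_le e1 e4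
  have t4 := norm_adR_le_of_le e2 e3
  have t5 := norm_adR_le_of_le e2 e4
  have t6 := norm_adR_le_of_le e3 e4
  linarith

omit [NormOneClass 𝔸] in
/-- The plaquette covariant derivative of a single-bond variation keeps its `η⁻¹`: `|(D^η_{U₀}ι_bX)(p)| ≤ 4η⁻¹‖X‖`.
[folklore] -/
theorem norm_plaqCovDeriv_bump_le [NormOneClass 𝔸] {η : ℝ} (hη : 0 < η) {U₀ : Site d → Fin d → 𝔸ˣ}
    (h₀ : ∀ y κ, U₀ y κ ∈ U1 𝔸) (y : Site d) (κ : Fin d) (X : 𝔸) (μ ν : Fin d) (x : Site d) :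
    ‖plaqCovDeriv η U₀ (bump y κ X) μ ν x‖ ≤ η⁻¹ * (4 * ‖X‖) := by
  rw [plaqCovDeriv, norm_smul, Real.norm_of_nonneg (inv_nonneg.2 hη.le)]
  exact mul_le_mul_of_nonneg_left (norm_lin_le h₀ (fun y' κ' => norm_bump_le y y' κ κ' X) μ ν x)
    (inv_nonneg.2 hη.le)

/-- **ONE STAR PLAQUETTE, NAIVELY**: for `p ∈ st(y, κ)` with the field `≤ a` on `nbhdSites y κ` and the covariant
derivatives `≤ G` on `baseSites y`, `‖δcub(B)[ι_{(y,κ)}X](p)‖ ≤ 48‖w‖‖τ‖·(a²η⁻¹ + aG)·‖X‖` — the `(DA)(p)`-slot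
bounded WITHOUT summation by parts (this is where print's one-grid bound sits; no `Lʲ` is lost at level 0). [folklore] -/
theorem norm_dcub_bump_le_at {η : ℝ} (hη : 0 < η) {U₀ : Site d → Fin d → 𝔸ˣ} (h₀ : ∀ y κ, U₀ y κ ∈ U1 𝔸)
    {B : Site d → Fin d → 𝔸} {a G : ℝ} {y : Site d} {κ : Fin d}
    (hB : ∀ (x : Site d) (μ : Fin d), x ∈ nbhdSites y κ → ‖B x μ‖ ≤ a)
    (hG : ∀ (x : Site d) (κ' τ : Fin d), x ∈ baseSites y → ‖covDerivFwd η U₀ κ' (fun z => B z τ) x‖ ≤ G)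
    (w : ℂ) (tr : 𝔸 →L[ℂ] ℂ) {p : Fin d × Fin d × Site d} (hp : p ∈ plaqStar y κ) (X : 𝔸) :
    ‖dcub w tr η U₀ B (bump y κ X) p.1 p.2.1 p.2.2‖ ≤ 48 * ‖w‖ * ‖tr‖ * (a * a * η⁻¹ + a * G) * ‖X‖ := by
  obtain ⟨hb, hx, hxμ, hxν⟩ := plaqStar_sites hp
  have ha : 0 ≤ a := (norm_nonneg _).trans (hB y κ (mem_nbhdSites_self y κ))
  have hGnn : 0 ≤ G := (norm_nonneg _).trans (hG y κ κ (mem_baseSites_self y))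
  have hX : ∀ y' κ', ‖bump y κ X y' κ'‖ ≤ ‖X‖ := fun y' κ' => norm_bump_le y y' κ κ' X
  have hP1 : ‖plaqCovDeriv η U₀ (bump y κ X) p.1 p.2.1 p.2.2‖ ≤ η⁻¹ * (4 * ‖X‖) :=
    norm_plaqCovDeriv_bump_le hη h₀ y κ X _ _ _
  have hK : ‖brk U₀ B p.1 p.2.1 p.2.2‖ ≤ 12 * a * a :=
    norm_brk_le_at h₀ (hB _ _ hx) (hB _ _ hxμ) (hB _ _ hxν) (hB _ _ hx)
  have hP2 : ‖plaqCovDeriv η U₀ B p.1 p.2.1 p.2.2‖ ≤ 2 * G := norm_plaqCovDeriv_le_at (hG _ _ _ hb) (hG _ _ _ hb)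
  have hD : ‖dbrk U₀ B (bump y κ X) p.1 p.2.1 p.2.2‖ ≤ 24 * a * ‖X‖ :=
    norm_dbrk_le_at h₀ (hB _ _ hx) (hB _ _ hxμ) (hB _ _ hxν) (hB _ _ hx) (hX _ _) (hX _ _) (hX _ _) (hX _ _)
  have h12 : 0 ≤ 12 * a * a := by positivity
  have hin : ‖plaqCovDeriv η U₀ (bump y κ X) p.1 p.2.1 p.2.2 * brk U₀ B p.1 p.2.1 p.2.2
      + plaqCovDeriv η U₀ B p.1 p.2.1 p.2.2 * dbrk U₀ B (bump y κ X) p.1 p.2.1 p.2.2‖ ≤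
        η⁻¹ * (4 * ‖X‖) * (12 * a * a) + 2 * G * (24 * a * ‖X‖) := by
    refine (norm_add_le _ _).trans (add_le_add ?_ ?_)
    · exact (norm_mul_le _ _).trans (mul_le_mul hP1 hK (norm_nonneg _) (by positivity))
    · exact (norm_mul_le _ _).trans (mul_le_mul hP2 hD (norm_nonneg _) (by positivity))
  rw [dcub, norm_mul]
  calc ‖w‖ * ‖tr (plaqCovDeriv η U₀ (bump y κ X) p.1 p.2.1 p.2.2 * brk U₀ B p.1 p.2.1 p.2.2
        + plaqCovDeriv η U₀ B p.1 p.2.1 p.2.2 * dbrk U₀ B (bump y κ X) p.1 p.2.1 p.2.2)‖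
      ≤ ‖w‖ * (‖tr‖ * (η⁻¹ * (4 * ‖X‖) * (12 * a * a) + 2 * G * (24 * a * ‖X‖))) :=
        mul_le_mul_of_nonneg_left ((tr.le_opNorm _).trans (mul_le_mul_of_nonneg_left hin (norm_nonneg tr)))
          (norm_nonneg w)
    _ = 48 * ‖w‖ * ‖tr‖ * (a * a * η⁻¹ + a * G) * ‖X‖ := by ring

/-- **THE NAIVE BOUND AT A BOND — NO STAR HYPOTHESIS.**  For ANY finite set `Pl` of increasing plaquettes, with the
field `≤ a` on `nbhdSites y κ` and the covariant derivatives `≤ G` on `baseSites y`: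
`‖Σ_{p∈Pl} δcub(B)[ι_{(y,κ)}X](p)‖ ≤ 96(d−1)‖w‖‖τ‖·(a²η⁻¹ + aG)·‖X‖` — only the `≤ 2(d−1)` star plaquettes PRESENT in
`Pl` contribute, each by `norm_dcub_bump_le_at`.  Compare leaf-05-g7's `norm_sum_dcub_bump_le_local`
(`144(d−1)‖w‖‖τ‖·aG·‖X‖`, NO `η⁻¹`) which needs the FULL star for the summation by parts (93). [folklore] -/
theorem norm_sum_dcub_bump_le_partial {η : ℝ} (hη : 0 < η) {U₀ : Site d → Fin d → 𝔸ˣ} (h₀ : ∀ y κ, U₀ y κ ∈ U1 𝔸)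
    {B : Site d → Fin d → 𝔸} {a G : ℝ} {y : Site d} {κ : Fin d}
    (hB : ∀ (x : Site d) (μ : Fin d), x ∈ nbhdSites y κ → ‖B x μ‖ ≤ a)
    (hG : ∀ (x : Site d) (κ' τ : Fin d), x ∈ baseSites y → ‖covDerivFwd η U₀ κ' (fun z => B z τ) x‖ ≤ G)
    (w : ℂ) (tr : 𝔸 →L[ℂ] ℂ) {Pl : Finset (Fin d × Fin d × Site d)} (hincr : ∀ p ∈ Pl, p.1 < p.2.1) (X : 𝔸) :
    ‖∑ p ∈ Pl, dcub w tr η U₀ B (bump y κ X) p.1 p.2.1 p.2.2‖ ≤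
      96 * ((d : ℝ) - 1) * ‖w‖ * ‖tr‖ * (a * a * η⁻¹ + a * G) * ‖X‖ := by
  have ha : 0 ≤ a := (norm_nonneg _).trans (hB y κ (mem_nbhdSites_self y κ))
  have hGnn : 0 ≤ G := (norm_nonneg _).trans (hG y κ κ (mem_baseSites_self y))
  -- only the star plaquettes present in `Pl` contribute
  have hvan : ∀ p ∈ Pl, p ∉ plaqStar y κ → dcub w tr η U₀ B (bump y κ X) p.1 p.2.1 p.2.2 = 0 :=
    fun p hp hps => dcub_bump_eq_zero w tr η U₀ B (hincr p hp) hps X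
  have hsum : ∑ p ∈ Pl, dcub w tr η U₀ B (bump y κ X) p.1 p.2.1 p.2.2 =
      ∑ p ∈ Pl.filter (fun p => p ∈ plaqStar y κ), dcub w tr η U₀ B (bump y κ X) p.1 p.2.1 p.2.2 := by
    rw [Finset.sum_filter]
    refine Finset.sum_congr rfl fun p hp => ?_
    split_ifs with h
    · rfl
    · exact hvan p hp h
  rw [hsum]
  have hcard : ((Pl.filter (fun p => p ∈ plaqStar y κ)).card : ℝ) ≤ 2 * ((d : ℝ) - 1) :=
    le_trans (by exact_mod_cast Finset.card_le_card fun p hp => (Finset.mem_filter.1 hp).2) (card_plaqStar_le y κ)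
  have hterm : ∀ p ∈ Pl.filter (fun p => p ∈ plaqStar y κ),
      ‖dcub w tr η U₀ B (bump y κ X) p.1 p.2.1 p.2.2‖ ≤ 48 * ‖w‖ * ‖tr‖ * (a * a * η⁻¹ + a * G) * ‖X‖ :=
    fun p hp => norm_dcub_bump_le_at hη h₀ hB hG w tr (Finset.mem_filter.1 hp).2 X
  refine (norm_sum_le_of_le _ hterm).trans ?_
  rw [Finset.sum_const, nsmul_eq_mul]
  have hnn : 0 ≤ 48 * ‖w‖ * ‖tr‖ * (a * a * η⁻¹ + a * G) * ‖X‖ := by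
    have : 0 ≤ η⁻¹ := inv_nonneg.2 hη.le
    positivity
  nlinarith

end Naive

/-! ## §2 The located bound of the `∇`-part at a LOWEST-SCALE bond, weighted -/

section Low

variable {𝔸 : Type*} [NormedRing 𝔸] [NormOneClass 𝔸] [NormedAlgebra ℂ 𝔸]
  (Λ : Finset (Site d × Fin d)) (Pl : Finset (Fin d × Fin d × Site d)) (w : ℂ) {τ : 𝔸 →L[ℂ] ℂ}
  (wt : ↥Λ → ℝ) [hwt : Fact (∀ b, 0 < wt b)] {I : Type*} [Fintype I] (wd : I → ℝ) [hwd : Fact (∀ i, 0 < wd i)]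
  (Dv : (↥Λ → 𝔸) →L[ℂ] (I → 𝔸)) (Wf Wd : ↥Λ → ℝ)

/-- **THE LOCATED BOUND OF THE `∇`-PART AT A LOWEST-SCALE BOND, WEIGHTED.**  For a bond `c` of `Λ` with weight
`wt c ≤ L_b·η` (B11 p. 277 (1) TYPE: the bonds whose star is incomplete are level-0 bonds), the local floors
`Wf c ≤ wt b` on `nbhdSites c`, `Wd c` (∇-datum domination on `baseSites c`), the scale jump (`wt c ≤ Lc·Wf c`,
`wt c ≤ Lc·Wd c`, `1 ≤ Lc`) and a global weighted field size `wt b‖A b‖ ≤ N₁` — and NO star hypothesis: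
`(wt c)³·‖locGrad (cubT …) A c‖ ≤ 96(d−1)‖w‖‖τ‖·(L_b·Lc²·((3d+2)d)·N₁ + Lc³·|Dv A|_{(−2)})·Σ_{b : b.1.1 ∈ nbhdSites c} wt b‖A b‖`.
The `η⁻¹` of the naive `(DA)(p)`-slot is paid by ONE factor `wt c ≤ L_b·η`; the other two factors `wt c` locate the
field as in S77 file 1. [folklore] -/
theorem weighted_locGrad_cubT_le_located_low {η : ℝ} (hη : 0 < η) {U₀ : Site d → Fin d → 𝔸ˣ}
    (h₀ : ∀ y κ, U₀ y κ ∈ U1 𝔸) (hincr : ∀ p ∈ Pl, p.1 < p.2.1)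
    {c : ↥Λ} {Lc Lb : ℝ} (hLc : 1 ≤ Lc) (hlow : wt c ≤ Lb * η) (hWd0 : 0 < Wd c)
    (hWf : ∀ b' : ↥Λ, b'.1.1 ∈ nbhdSites c.1.1 c.1.2 → Wf c ≤ wt b')
    (hcf : wt c ≤ Lc * Wf c) (hcd : wt c ≤ Lc * Wd c)
    (hDv : ∀ (A : ↥Λ → 𝔸) (x : Site d) (κ' τ' : Fin d), x ∈ baseSites c.1.1 →
      Wd c ^ 2 * ‖covDerivFwd η U₀ κ' (fun z => ext Λ A z τ') x‖ ≤ ‖(WSup.toPiL wd 2).symm (Dv A)‖)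
    (A : ↥Λ → 𝔸) {N₁ : ℝ} (hA1 : ∀ b, wt b * ‖A b‖ ≤ N₁) :
    wt c ^ 3 * ‖locGrad (cubT Λ Pl w τ η U₀) A c‖ ≤
      96 * ((d : ℝ) - 1) * ‖w‖ * ‖τ‖ * (Lb * Lc ^ 2 * ((3 * d + 2) * d : ℕ) * N₁
          + Lc ^ 3 * ‖(WSup.toPiL wd 2).symm (Dv A)‖) *
        ∑ b ∈ Finset.univ.filter (fun b : ↥Λ => b.1.1 ∈ nbhdSites c.1.1 c.1.2), wt b * ‖A b‖ := by
  have hd : 0 ≤ (d : ℝ) - 1 := by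
    have : 1 ≤ d := Nat.succ_le_of_lt (Fin.pos c.1.2)
    have : (1 : ℝ) ≤ d := by exact_mod_cast this
    linarith
  have hLc0 : 0 ≤ Lc := zero_le_one.trans hLc
  set a := ∑ b ∈ Finset.univ.filter (fun b : ↥Λ => b.1.1 ∈ nbhdSites c.1.1 c.1.2), ‖A b‖ with ha_def
  set N := ‖(WSup.toPiL wd 2).symm (Dv A)‖ with hN_def
  set S := ∑ b ∈ Finset.univ.filter (fun b : ↥Λ => b.1.1 ∈ nbhdSites c.1.1 c.1.2), wt b * ‖A b‖ with hS_def
  have ha0 : 0 ≤ a := Finset.sum_nonneg fun b _ => norm_nonneg _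
  have hN0 : 0 ≤ N := norm_nonneg _
  have hS0 : 0 ≤ S := Finset.sum_nonneg fun b _ => mul_nonneg (hwt.out b).le (norm_nonneg _)
  have hN₁ : 0 ≤ N₁ := (mul_nonneg (hwt.out c).le (norm_nonneg _)).trans (hA1 c)
  have hB : ∀ (x : Site d) (μ : Fin d), x ∈ nbhdSites c.1.1 c.1.2 → ‖ext Λ A x μ‖ ≤ a :=
    fun x μ hx => norm_ext_le_sum_nbhd Λ A c hx μ
  have hG : ∀ (x : Site d) (κ' τ' : Fin d), x ∈ baseSites c.1.1 →
      ‖covDerivFwd η U₀ κ' (fun z => ext Λ A z τ') x‖ ≤ N / Wd c ^ 2 := by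
    intro x κ' τ' hx
    rw [le_div_iff₀ (pow_pos hWd0 2), mul_comm]
    exact hDv A x κ' τ' hx
  -- the flat NAIVE bound (§1)
  have hK : 0 ≤ 96 * ((d : ℝ) - 1) * ‖w‖ * ‖τ‖ * (a * a * η⁻¹ + a * (N / Wd c ^ 2)) := by
    have : 0 ≤ η⁻¹ := inv_nonneg.2 hη.le
    positivity
  have hflat : ‖locGrad (cubT Λ Pl w τ η U₀) A c‖ ≤
      96 * ((d : ℝ) - 1) * ‖w‖ * ‖τ‖ * (a * a * η⁻¹ + a * (N / Wd c ^ 2)) := by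
    refine ShellMeasureCommutatorLocGrad.norm_locGrad_cubT_le Λ Pl w τ η U₀ A c hK fun X => ?_
    exact norm_sum_dcub_bump_le_partial hη h₀ hB hG w τ hincr X
  -- the weights: floor, count, lowest scale
  have hfloor : Wf c * a ≤ S := by
    rw [ha_def, Finset.mul_sum]
    refine Finset.sum_le_sum fun b hb => ?_
    exact mul_le_mul_of_nonneg_right (hWf b (Finset.mem_filter.1 hb).2) (norm_nonneg _)
  have hwt0 : 0 ≤ wt c := (hwt.out c).le
  have h1 : wt c * a ≤ Lc * S := by
    calc wt c * a ≤ Lc * Wf c * a := mul_le_mul_of_nonneg_right hcf ha0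
      _ = Lc * (Wf c * a) := by ring
      _ ≤ Lc * S := mul_le_mul_of_nonneg_left hfloor hLc0
  have hcount : S ≤ ((3 * d + 2) * d : ℕ) * N₁ := by
    calc S ≤ ∑ _b ∈ Finset.univ.filter (fun b : ↥Λ => b.1.1 ∈ nbhdSites c.1.1 c.1.2), N₁ :=
          Finset.sum_le_sum fun b _ => hA1 b
      _ = ((Finset.univ.filter (fun b : ↥Λ => b.1.1 ∈ nbhdSites c.1.1 c.1.2)).card : ℝ) * N₁ := by
          rw [Finset.sum_const, nsmul_eq_mul]
      _ ≤ ((3 * d + 2) * d : ℕ) * N₁ := by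
          have h := card_filter_nbhd_le Λ c
          exact mul_le_mul_of_nonneg_right (by exact_mod_cast h) hN₁
  have h1' : wt c * a ≤ Lc * (((3 * d + 2) * d : ℕ) * N₁) := h1.trans (mul_le_mul_of_nonneg_left hcount hLc0)
  have h3 : wt c * η⁻¹ ≤ Lb := by
    rw [← div_eq_mul_inv, div_le_iff₀ hη]
    exact hlow
  -- term 1: `(wt c)³·a²η⁻¹ ≤ L_b·Lc²·((3d+2)d)·N₁·S`
  have hT1 : wt c ^ 3 * (a * a * η⁻¹) ≤ Lb * Lc ^ 2 * ((3 * d + 2) * d : ℕ) * N₁ * S := by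
    have e : wt c ^ 3 * (a * a * η⁻¹) = (wt c * a) * (wt c * a) * (wt c * η⁻¹) := by ring
    rw [e]
    have hwa : 0 ≤ wt c * a := mul_nonneg hwt0 ha0
    calc (wt c * a) * (wt c * a) * (wt c * η⁻¹)
        ≤ (Lc * S) * (Lc * (((3 * d + 2) * d : ℕ) * N₁)) * Lb := by
          have := mul_le_mul h1 h1' hwa (hwa.trans h1)
          exact mul_le_mul this h3 (mul_nonneg hwt0 (inv_nonneg.2 hη.le)) ((mul_nonneg hwa hwa).trans this)
      _ = Lb * Lc ^ 2 * ((3 * d + 2) * d : ℕ) * N₁ * S := by ring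
  -- term 2: `(wt c)³·a·N∕Wd² ≤ Lc³·N·S` (as S77 file 1)
  have hT2 : wt c ^ 3 * (a * (N / Wd c ^ 2)) ≤ Lc ^ 3 * N * S := by
    have hsq : wt c ^ 2 ≤ (Lc * Wd c) ^ 2 := pow_le_pow_left₀ hwt0 hcd 2
    have h2 : wt c ^ 2 * (N / Wd c ^ 2) ≤ Lc ^ 2 * N := by
      rw [mul_div_assoc', div_le_iff₀ (pow_pos hWd0 2)]
      calc wt c ^ 2 * N ≤ (Lc * Wd c) ^ 2 * N := mul_le_mul_of_nonneg_right hsq hN0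
        _ = Lc ^ 2 * N * Wd c ^ 2 := by ring
    have e : wt c ^ 3 * (a * (N / Wd c ^ 2)) = (wt c * a) * (wt c ^ 2 * (N / Wd c ^ 2)) := by ring
    rw [e]
    calc (wt c * a) * (wt c ^ 2 * (N / Wd c ^ 2)) ≤ (Lc * S) * (Lc ^ 2 * N) :=
          mul_le_mul h1 h2 (by positivity) ((mul_nonneg hwt0 ha0).trans h1)
      _ = Lc ^ 3 * N * S := by ring
  have hK' : 0 ≤ 96 * ((d : ℝ) - 1) * ‖w‖ * ‖τ‖ := by positivity
  calc wt c ^ 3 * ‖locGrad (cubT Λ Pl w τ η U₀) A c‖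
      ≤ wt c ^ 3 * (96 * ((d : ℝ) - 1) * ‖w‖ * ‖τ‖ * (a * a * η⁻¹ + a * (N / Wd c ^ 2))) :=
        mul_le_mul_of_nonneg_left hflat (pow_nonneg hwt0 3)
    _ = 96 * ((d : ℝ) - 1) * ‖w‖ * ‖τ‖ * (wt c ^ 3 * (a * a * η⁻¹) + wt c ^ 3 * (a * (N / Wd c ^ 2))) := by ring
    _ ≤ 96 * ((d : ℝ) - 1) * ‖w‖ * ‖τ‖ *
          (Lb * Lc ^ 2 * ((3 * d + 2) * d : ℕ) * N₁ * S + Lc ^ 3 * N * S) :=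
        mul_le_mul_of_nonneg_left (add_le_add hT1 hT2) hK'
    _ = _ := by ring

end Low




end Summit.QuantumFields.BalabanUV.T4Continuum.ShellMeasurePlaquetteCubicBoundary

end
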